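import Summits.QuantumFields.QCD.Theorems.GapBuysCauchyRateLadderCauchyRateDefs
import Summits.QuantumFields.QCD.Theorems.GapBuysCauchyRateLadderCauchyRateStubSchwingerMultilinear
import Summits.QuantumFields.QCD.Theorems.GapBuysCauchyRateLadderCauchyRateStubSpeciesMultilinear
import Summits.QuantumFields.QCD.Theorems.GapBuysCauchyRateLadderCauchyRateStubOnePointTranslation
import Summits.QuantumFields.QCD.Theorems.GapBuysCauchyRateLadderCauchyRateStubKappa3Transfer
import HarnessLib

/-!
# Pinning laws of calibrated species families — line `registered` (birth) of crux `LadderCauchyRate`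
(item stmt-QuantumFields-17307; route GapBuysCauchyRate, sub-problem QCD)

Helper theorems (`--supports stmt-QuantumFields-17307`) for the CONVERSE transfer
`LadderCauchyRate → SymanzikLadderBareStmt` (sibling file `…BareOfLadder.lean`): the renormalisation
data `(z, shift)` of a calibrated species family are NOT free on the honest branch of the lattice
functional.  At every step `k` at which the torus partition function of `reg` at the mass tuple `m`
does not vanish:

* `shift_eq_pinnedShiftOf` — the one-point subtraction forces `shift_s(m,k) = Re ⟨O_s(0)⟩` (tested on
  a nonnegative bump with positive lattice sum; torus translation invariance T);
* `z_eq_of_pinned` — a family with pinned counterterms and multiplicative renormalisations pinned with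
  the off-proviso values `ζ := 𝒞.z` of a calibrated family `𝒞` has the SAME `z` as `𝒞` (the two-point
  calibration fixes `z = C_bare^{-1/2}` on the proviso branch for both);
* `schwinger_eq_of_pinned` — hence ALL lattice `n`-point functions of the two families coincide, at
  every step (on the junk branch both vanish);
* `refB_eq_of_twoPoint_eq_one`, `bareRefPositivity_of_calibration`, `bareSkewness_of_kappa3` — the
  crux's calibration clause (iii) and `κ₃` clause (iv) for a calibrated family give bare reference
  positivity and bare skewness of `reg` (the converses of the landed laws W2/W3/W6 read pointwise).

Sources: Montvay–Münster 1994 §1.7 (1.251)–(1.253), §5.1 (renormalisation conditions); Glimm–Jaffe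
1987 §6.1 (truncated functions).  Pure theorem file: no definitions, no `sorry`.
-/

noncomputable section

namespace Summit.QuantumFields.QCD.Cruxes.LadderCauchyRate.Birth

open scoped BigOperators Topology Classical
open MeasureTheory Filter
open Literature.MathematicalPhysics.AQFT Literature.Probability.LatticeModels
  Literature.MathematicalPhysics.QuantumLattice Literature.MathematicalPhysics.QuantumFieldTheory
open Summit.QuantumFields.QCD.Theses.GapBuysCauchyRate
open Summit.QuantumFields.QCD.Cruxes.StableActionBridge.Sketch

variable {Nf : ℕ}

/-! ## §1 Closed form, congruence and the junk branch -/

/-- The species renormalisations factor out of the torus moments (copy of the private lemma of the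
landed W1 file). -/
private theorem torusMomentStr_zFactor (sch : QCDScheme Nf) (k : ℕ) {n : ℕ}
    (σ : Fin n → QCDField Nf) (x : Fin n → Literature.Probability.LatticeModels.Site 4) :
    qcdTorusMomentStr sch k σ x =
      (∏ i, ((sch.z (σ i) k * sch.a k ^ 4 : ℝ) : ℂ)) *
        qcdTorusExpect (sch.β k) (sch.side k) (fun fl => sch.mq fl k)
          (fun U => (List.ofFn fun i => (insertion U (σ i) (x i) -
            algebraMap ℂ _ ((sch.shift (σ i) k : ℝ) : ℂ))).prod) := by
  unfold qcdTorusMomentStr qcdTorusExpect qcdGaugeMeasure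
  simp only [renormInsertion, prod_ofFn_smul, smul_mul_assoc, map_smul, smul_eq_mul,
    integral_const_mul]
  rw [mul_div_assoc]

/-- Closed form of the `n`-point functions of `reg.scheme m zz shift` (`n ≥ 1`): the whole
`(zz, shift)`-dependence is explicit and only through the values `zz_{σᵢ}(k)`, `shift_{σᵢ}(k)` (copy
of the private lemma of the landed W1 file). -/
private theorem schwingerSchemeClosedForm (reg : QCDRegularisation Nf) (m : Fin Nf → ℝ)
    (zz shift : QCDField Nf → ℕ → ℝ) (k n : ℕ) (hn : n ≠ 0) (σ : Fin n → QCDField Nf)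
    (f : Fin n → SchwartzMap (EuclideanSpace ℝ (Fin 4)) ℝ) :
    qcdLatticeSchwinger (reg.scheme m zz shift) k n σ f =
      ∑ x ∈ Fintype.piFinset (fun _ : Fin n => Literature.Probability.LatticeModels.box 4 (reg.L k)),
        ((∏ i, ((zz (σ i) k * reg.a k ^ 4 : ℝ) : ℂ)) *
          qcdTorusExpect (reg.β k) (2 * reg.L k + 1) (fun fl => (reg.scheme m 0 0).mq fl k)
            (fun U => (List.ofFn fun i => (insertion U (σ i) (x i) -
              algebraMap ℂ _ ((shift (σ i) k : ℝ) : ℂ))).prod)) *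
        ∏ i, ((f i (reg.a k • siteToE (x i)) : ℝ) : ℂ) := by
  rw [← qcdLatticeSchwinger_eq_qcdLatticeDist _ k n hn σ f _ (isTensorOf_tensorFin _),
    qcdLatticeDist_apply _ k hn]
  refine Finset.sum_congr rfl fun x _ => ?_
  rw [SchwartzMap.tensorFin_apply, torusMomentStr_zFactor]
  rfl

/-- Degree `0`: the `0`-point function of `reg.scheme m zz shift` is `⟨1⟩` (copy of the private lemma of
the landed W1 file). -/
private theorem schwingerSchemeZero (reg : QCDRegularisation Nf) (m : Fin Nf → ℝ)
    (zz shift : QCDField Nf → ℕ → ℝ) (k : ℕ) (σ : Fin 0 → QCDField Nf)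
    (f : Fin 0 → SchwartzMap (EuclideanSpace ℝ (Fin 4)) ℝ) :
    qcdLatticeSchwinger (reg.scheme m zz shift) k 0 σ f =
      qcdTorusExpect (reg.β k) (2 * reg.L k + 1) (fun fl => (reg.scheme m 0 0).mq fl k) (fun _ => 1) := by
  unfold qcdLatticeSchwinger qcdTorusExpect
  simp only [List.ofFn_zero, List.prod_nil]
  rfl

/-- **Congruence in the species data.** The step-`k` lattice `n`-point function of `reg.scheme m z shift`
depends on `(z, shift)` only through the values `z_{σᵢ}(k)`, `shift_{σᵢ}(k)` of the species occurring
in the string. -/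
theorem schwinger_congr (reg : QCDRegularisation Nf) (m : Fin Nf → ℝ)
    {z₁ s₁ z₂ s₂ : QCDField Nf → ℕ → ℝ} {k n : ℕ} {σ : Fin n → QCDField Nf}
    (f : Fin n → SchwartzMap (EuclideanSpace ℝ (Fin 4)) ℝ)
    (hz : ∀ i, z₁ (σ i) k = z₂ (σ i) k) (hs : ∀ i, s₁ (σ i) k = s₂ (σ i) k) :
    qcdLatticeSchwinger (reg.scheme m z₁ s₁) k n σ f = qcdLatticeSchwinger (reg.scheme m z₂ s₂) k n σ f := by
  rcases eq_or_ne n 0 with rfl | hn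
  · rw [schwingerSchemeZero, schwingerSchemeZero]
  · rw [schwingerSchemeClosedForm reg m z₁ s₁ k n hn, schwingerSchemeClosedForm reg m z₂ s₂ k n hn]
    simp only [hz, hs]

/-- **The junk branch.** If the torus partition function of `reg` at `(m, k)` vanishes, every lattice
`n`-point function of every scheme `reg.scheme m z shift` at step `k` is the junk value `0`. -/
theorem schwinger_eq_zero_of_den_eq_zero (reg : QCDRegularisation Nf) (m : Fin Nf → ℝ)
    (z shift : QCDField Nf → ℕ → ℝ) {k : ℕ}
    (hD : ∫ U, fermiIntegral (fermiBoltzmann U fun fl => (reg.scheme m 0 0).mq fl k)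
      ∂(wilsonMeasure (d := 4) (L := 2 * reg.L k + 1) (fundamentalRep (Fin 3)) (reg.β k)) = 0)
    (n : ℕ) (σ : Fin n → QCDField Nf) (f : Fin n → SchwartzMap (EuclideanSpace ℝ (Fin 4)) ℝ) :
    qcdLatticeSchwinger (reg.scheme m z shift) k n σ f = 0 := by
  rcases eq_or_ne n 0 with rfl | hn
  · rw [schwingerSchemeZero]
    unfold qcdTorusExpect
    rw [hD, div_zero]
  · rw [schwingerSchemeClosedForm reg m z shift k n hn]
    refine Finset.sum_eq_zero fun x _ => ?_
    unfold qcdTorusExpect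
    rw [hD, div_zero, mul_zero, zero_mul]

/-- **The honest branch.** If the torus partition function does not vanish, `⟨1⟩ = 1`. -/
theorem qcdTorusExpect_one_of_den_ne_zero (reg : QCDRegularisation Nf) (m : Fin Nf → ℝ) {k : ℕ}
    (hD : ∫ U, fermiIntegral (fermiBoltzmann U fun fl => (reg.scheme m 0 0).mq fl k)
      ∂(wilsonMeasure (d := 4) (L := 2 * reg.L k + 1) (fundamentalRep (Fin 3)) (reg.β k)) ≠ 0) :
    qcdTorusExpect (reg.β k) (2 * reg.L k + 1) (fun fl => (reg.scheme m 0 0).mq fl k) (fun _ => 1) = 1 := by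
  unfold qcdTorusExpect
  simp only [one_mul]
  exact div_self hD

/-! ## §2 Pinning of calibrated families on the honest branch -/

/-- There is a real Schwartz function on `ℝ⁴` that is everywhere nonnegative and positive at `0`
(a smooth bump turned into a Schwartz map). -/
theorem exists_schwartz_nonneg_pos_at_zero :
    ∃ f : SchwartzMap (EuclideanSpace ℝ (Fin 4)) ℝ, (∀ x, 0 ≤ f x) ∧ 0 < f 0 := by
  let b : ContDiffBump (0 : EuclideanSpace ℝ (Fin 4)) := ⟨1, 2, one_pos, one_lt_two⟩
  refine ⟨b.hasCompactSupport.toSchwartzMap b.contDiff, fun x => ?_, ?_⟩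
  · simp only [HasCompactSupport.toSchwartzMap_toFun]
    exact b.nonneg
  · simp only [HasCompactSupport.toSchwartzMap_toFun]
    rw [b.one_of_mem_closedBall (Metric.mem_closedBall_self b.rIn_pos.le)]
    exact one_pos

/-- The lattice sum of a nonnegative test function positive at the origin is positive (the origin is a
box point). -/
theorem latticeSum_pos (reg : QCDRegularisation Nf) (k : ℕ) {φ : SchwartzMap (EuclideanSpace ℝ (Fin 4)) ℝ}
    (hφ0 : ∀ x, 0 ≤ φ x) (hφpos : 0 < φ 0) :
    0 < ∑ x ∈ Literature.Probability.LatticeModels.box 4 (reg.L k), reg.a k ^ 4 * φ (reg.a k • siteToE x) := by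
  refine Finset.sum_pos' (fun x _ => mul_nonneg (pow_nonneg (reg.a_pos k).le 4) (hφ0 _))
    ⟨0, zero_mem_box 4 (reg.L k), ?_⟩
  have h0 : siteToE (0 : Literature.Probability.LatticeModels.Site 4) = 0 := by
    ext i
    rw [siteToE_apply]
    simp
  rw [h0, smul_zero]
  exact mul_pos (pow_pos (reg.a_pos k) 4) hφpos

/-- **The one-point subtraction pins the counterterms** on the honest branch: for every calibrated
family, `shift_s(m,k) = Re ⟨O_s(0)⟩_{k,m}` (`= pinnedShiftOf reg m s k`) whenever the torus partition
function of `reg` at `(m,k)` does not vanish. -/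
theorem shift_eq_pinnedShiftOf {reg : QCDRegularisation Nf} (𝒞 : CalibratedSpeciesFamily reg)
    (m : Fin Nf → ℝ) (s : QCDField Nf) {k : ℕ}
    (hD : ∫ U, fermiIntegral (fermiBoltzmann U fun fl => (reg.scheme m 0 0).mq fl k)
      ∂(wilsonMeasure (d := 4) (L := 2 * reg.L k + 1) (fundamentalRep (Fin 3)) (reg.β k)) ≠ 0) :
    𝒞.shift m s k = pinnedShiftOf reg m s k := by
  obtain ⟨φ, hφ0, hφpos⟩ := exists_schwartz_nonneg_pos_at_zero
  have hsub := 𝒞.onePointSubtracted m s k φ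
  obtain ⟨h1, -, h3⟩ := stub_speciesMultilinear Nf reg m (𝒞.z m) (𝒞.shift m) k s φ φ
  have hT := fun x => (stub_onePointTranslation Nf (reg.L k) (reg.β k)
    (fun fl => (reg.scheme m 0 0).mq fl k)).1 s x
  have hE1 := qcdTorusExpect_one_of_den_ne_zero reg m hD
  have hz : ((𝒞.z m s k : ℝ) : ℂ) ≠ 0 := Complex.ofReal_ne_zero.2 (𝒞.z_ne_zero m s k)
  -- the bare one-point function vanishes
  have hone : (reg.scheme m (fun _ _ => (1 : ℝ)) (𝒞.shift m)).onePoint k s φ = 0 := by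
    rw [h1] at hsub
    exact (mul_eq_zero.1 hsub).resolve_left hz
  -- and it is (Σ c_x) · (⟨O_s(0)⟩ − shift)
  have hsum : (reg.scheme m (fun _ _ => (1 : ℝ)) (𝒞.shift m)).onePoint k s φ =
      (((∑ x ∈ Literature.Probability.LatticeModels.box 4 (reg.L k),
          reg.a k ^ 4 * φ (reg.a k • siteToE x) : ℝ) : ℂ)) *
        (qcdTorusExpect (reg.β k) (2 * reg.L k + 1) (fun fl => (reg.scheme m 0 0).mq fl k)
            (fun U => insertion U s 0) - ((𝒞.shift m s k : ℝ) : ℂ)) := by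
    rw [h3, Complex.ofReal_sum, Finset.sum_mul]
    refine Finset.sum_congr rfl fun x _ => ?_
    rw [hT x, hE1, mul_one]
  have hcoef : ((∑ x ∈ Literature.Probability.LatticeModels.box 4 (reg.L k),
      reg.a k ^ 4 * φ (reg.a k • siteToE x) : ℝ) : ℂ) ≠ 0 :=
    Complex.ofReal_ne_zero.2 (latticeSum_pos reg k hφ0 hφpos).ne'
  have hE0 : qcdTorusExpect (reg.β k) (2 * reg.L k + 1) (fun fl => (reg.scheme m 0 0).mq fl k)
      (fun U => insertion U s 0) = ((𝒞.shift m s k : ℝ) : ℂ) := by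
    rw [hsum] at hone
    exact sub_eq_zero.1 ((mul_eq_zero.1 hone).resolve_left hcoef)
  simp only [pinnedShiftOf, hE0, Complex.ofReal_re]

/-- **Connected two-point scaling** (E1): `⟨Φ^s Φ^s⟩_conn` of `reg.scheme m z shift` is `z_s(k)²` times
that of the `z ≡ 1` scheme with the same counterterms. -/
theorem connectedTwoPoint_scale (reg : QCDRegularisation Nf) (m : Fin Nf → ℝ)
    (z shift : QCDField Nf → ℕ → ℝ) (k : ℕ) (s : QCDField Nf)
    (g f : SchwartzMap (EuclideanSpace ℝ (Fin 4)) ℝ) :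
    (reg.scheme m z shift).connectedTwoPoint k s s g f =
      ((z s k : ℝ) : ℂ) ^ 2 * (reg.scheme m (fun _ _ => (1 : ℝ)) shift).connectedTwoPoint k s s g f := by
  obtain ⟨h1f, h2, -⟩ := stub_speciesMultilinear Nf reg m z shift k s g f
  obtain ⟨h1g, -, -⟩ := stub_speciesMultilinear Nf reg m z shift k s f g
  simp only [QCDScheme.connectedTwoPoint, h2, h1f, h1g]
  ring

/-- Congruence of the bare calibrating function in the counterterm of the calibrated species. -/
theorem connectedTwoPoint_congr_shift (reg : QCDRegularisation Nf) (m : Fin Nf → ℝ)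
    {s₁ s₂ : QCDField Nf → ℕ → ℝ} {k : ℕ} {s : QCDField Nf}
    (g f : SchwartzMap (EuclideanSpace ℝ (Fin 4)) ℝ) (h : s₁ s k = s₂ s k) :
    (reg.scheme m (fun _ _ => (1 : ℝ)) s₁).connectedTwoPoint k s s g f =
      (reg.scheme m (fun _ _ => (1 : ℝ)) s₂).connectedTwoPoint k s s g f := by
  simp only [QCDScheme.connectedTwoPoint, QCDScheme.twoPoint_eq, QCDScheme.onePoint_eq]
  rw [schwinger_congr reg m ![g, f] (fun _ => rfl) (fun i => by fin_cases i <;> exact h),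
    schwinger_congr reg m (z₁ := fun _ _ => (1 : ℝ)) (z₂ := fun _ _ => (1 : ℝ)) (σ := fun _ => s)
      (fun _ => g) (fun _ => rfl) (fun _ => h),
    schwinger_congr reg m (z₁ := fun _ _ => (1 : ℝ)) (z₂ := fun _ _ => (1 : ℝ)) (σ := fun _ => s)
      (fun _ => f) (fun _ => rfl) (fun _ => h)]

/-- **The two-point calibration pins the multiplicative renormalisations** on the honest branch: a
calibrated family `𝒞'` with the reference datum of `𝒞`, pinned counterterms and multiplicative
renormalisations pinned with the off-proviso values `ζ := 𝒞.z` has the same `z` as `𝒞` at every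
honest step. -/
theorem z_eq_of_pinned {reg : QCDRegularisation Nf} (𝒞 𝒞' : CalibratedSpeciesFamily reg)
    (hf₀ : 𝒞'.f₀ = 𝒞.f₀) (hps' : PinnedShift reg 𝒞') (hpz' : PinnedZ reg 𝒞.z 𝒞')
    (m : Fin Nf → ℝ) (s : QCDField Nf) {k : ℕ}
    (hD : ∫ U, fermiIntegral (fermiBoltzmann U fun fl => (reg.scheme m 0 0).mq fl k)
      ∂(wilsonMeasure (d := 4) (L := 2 * reg.L k + 1) (fundamentalRep (Fin 3)) (reg.β k)) ≠ 0) :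
    𝒞'.z m s k = 𝒞.z m s k := by
  -- both counterterms are pinned at `(m, s, k)`
  have hsh : 𝒞'.shift m s k = 𝒞.shift m s k := by
    rw [shift_eq_pinnedShiftOf 𝒞 m s hD, pinnedShiftOf, hps' m s k]
  have hpz := hpz' m s k
  rw [hf₀, connectedTwoPoint_congr_shift reg m (thetaTest 4 𝒞.f₀) 𝒞.f₀ hsh] at hpz
  set C₁ := (reg.scheme m (fun _ _ => (1 : ℝ)) (𝒞.shift m)).connectedTwoPoint k s s
    (thetaTest 4 𝒞.f₀) 𝒞.f₀ with hC₁
  by_cases hprov : 0 < C₁.re ∧ C₁.im = 0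
  · -- proviso branch: both equal `(√ Re C₁)⁻¹`
    rw [hpz.1 hprov]
    have hzpos := 𝒞.z_pos m s k
    have hscale := connectedTwoPoint_scale reg m (𝒞.z m) (𝒞.shift m) k s (thetaTest 4 𝒞.f₀) 𝒞.f₀
    have hre : ((reg.scheme m (𝒞.z m) (𝒞.shift m)).connectedTwoPoint k s s (thetaTest 4 𝒞.f₀) 𝒞.f₀).re =
        𝒞.z m s k ^ 2 * C₁.re := by
      rw [hscale, ← Complex.ofReal_pow, Complex.re_ofReal_mul]
    have him : ((reg.scheme m (𝒞.z m) (𝒞.shift m)).connectedTwoPoint k s s (thetaTest 4 𝒞.f₀) 𝒞.f₀).im =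
        𝒞.z m s k ^ 2 * C₁.im := by
      rw [hscale, ← Complex.ofReal_pow, Complex.im_ofReal_mul]
    have h1 : (reg.scheme m (𝒞.z m) (𝒞.shift m)).connectedTwoPoint k s s (thetaTest 4 𝒞.f₀) 𝒞.f₀ = 1 :=
      𝒞.calibrated m s k (by rw [hre]; exact mul_pos (pow_pos hzpos 2) hprov.1)
        (by rw [him, hprov.2, mul_zero])
    have h2 : 𝒞.z m s k ^ 2 * C₁.re = 1 := by
      have := congrArg Complex.re h1
      rwa [hre, Complex.one_re] at this
    have hC1 : C₁.re = (𝒞.z m s k ^ 2)⁻¹ := eq_inv_of_mul_eq_one_right h2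
    rw [hC1, Real.sqrt_inv, Real.sqrt_sq hzpos.le, inv_inv]
  · exact hpz.2 hprov

/-- **A pinned family has the lattice `n`-point functions of `𝒞`** (all masses, all steps, all
problems): on the junk branch both vanish, on the honest branch their `(z, shift)` coincide on every
species of the string. -/
theorem schwinger_eq_of_pinned {reg : QCDRegularisation Nf} (𝒞 𝒞' : CalibratedSpeciesFamily reg)
    (hf₀ : 𝒞'.f₀ = 𝒞.f₀) (hps' : PinnedShift reg 𝒞') (hpz' : PinnedZ reg 𝒞.z 𝒞')
    (m : Fin Nf → ℝ) (k n : ℕ) (σ : Fin n → QCDField Nf)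
    (f : Fin n → SchwartzMap (EuclideanSpace ℝ (Fin 4)) ℝ) :
    qcdLatticeSchwinger (𝒞'.scheme m) k n σ f = qcdLatticeSchwinger (𝒞.scheme m) k n σ f := by
  rw [CalibratedSpeciesFamily.scheme_eq, CalibratedSpeciesFamily.scheme_eq]
  by_cases hD : ∫ U, fermiIntegral (fermiBoltzmann U fun fl => (reg.scheme m 0 0).mq fl k)
      ∂(wilsonMeasure (d := 4) (L := 2 * reg.L k + 1) (fundamentalRep (Fin 3)) (reg.β k)) = 0
  · rw [schwinger_eq_zero_of_den_eq_zero reg m _ _ hD, schwinger_eq_zero_of_den_eq_zero reg m _ _ hD]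
  · exact schwinger_congr reg m f (fun i => z_eq_of_pinned 𝒞 𝒞' hf₀ hps' hpz' m (σ i) hD)
      (fun i => by rw [shift_eq_pinnedShiftOf 𝒞 m (σ i) hD, pinnedShiftOf, hps' m (σ i) k])

/-! ## §3 The crux's clauses (iii), (iv) give bare reference positivity and bare skewness -/

/-- A step at which some two-point function of `𝒞` equals `1` is an honest step (the torus partition
function does not vanish). -/
theorem den_ne_zero_of_twoPoint_eq_one {reg : QCDRegularisation Nf} (𝒞 : CalibratedSpeciesFamily reg)
    {m : Fin Nf → ℝ} {s : QCDField Nf} {k : ℕ} {g f : SchwartzMap (EuclideanSpace ℝ (Fin 4)) ℝ}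
    (h1 : (𝒞.scheme m).twoPoint k s s g f = 1) :
    ∫ U, fermiIntegral (fermiBoltzmann U fun fl => (reg.scheme m 0 0).mq fl k)
      ∂(wilsonMeasure (d := 4) (L := 2 * reg.L k + 1) (fundamentalRep (Fin 3)) (reg.β k)) ≠ 0 := by
  intro hD
  rw [CalibratedSpeciesFamily.scheme_eq, QCDScheme.twoPoint_eq,
    schwinger_eq_zero_of_den_eq_zero reg m _ _ hD] at h1
  exact zero_ne_one h1

/-- **Calibration identity ⇒ the bare reference function is `z⁻²`.**  If the calibrated two-point
function of species `s` on the reference pair equals `1` at step `k`, then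
`refB reg m f₀ s k = z_s(m,k)⁻²` (E1 scaling + the pinned counterterm of `s` at the honest step `k`). -/
theorem refB_eq_of_twoPoint_eq_one {reg : QCDRegularisation Nf} (𝒞 : CalibratedSpeciesFamily reg)
    {m : Fin Nf → ℝ} {s : QCDField Nf} {k : ℕ}
    (h1 : (𝒞.scheme m).twoPoint k s s (thetaTest 4 𝒞.f₀) 𝒞.f₀ = 1) :
    refB reg m 𝒞.f₀ s k = ((((𝒞.z m s k) ^ 2)⁻¹ : ℝ) : ℂ) := by
  have hD := den_ne_zero_of_twoPoint_eq_one 𝒞 h1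
  have hconn : (reg.scheme m (𝒞.z m) (𝒞.shift m)).connectedTwoPoint k s s (thetaTest 4 𝒞.f₀) 𝒞.f₀ = 1 := by
    rw [← CalibratedSpeciesFamily.scheme_eq, 𝒞.connectedTwoPoint_eq]
    exact h1
  rw [connectedTwoPoint_scale] at hconn
  have hsh : pinnedShiftOf reg m s k = 𝒞.shift m s k := (shift_eq_pinnedShiftOf 𝒞 m s hD).symm
  rw [refB, connectedTwoPoint_congr_shift reg m (thetaTest 4 𝒞.f₀) 𝒞.f₀ hsh, Complex.ofReal_inv,
    Complex.ofReal_pow]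
  exact eq_inv_of_mul_eq_one_right hconn

/-- The bare reference function is then a positive real. -/
theorem refB_pos_of_twoPoint_eq_one {reg : QCDRegularisation Nf} (𝒞 : CalibratedSpeciesFamily reg)
    {m : Fin Nf → ℝ} {s : QCDField Nf} {k : ℕ}
    (h1 : (𝒞.scheme m).twoPoint k s s (thetaTest 4 𝒞.f₀) 𝒞.f₀ = 1) :
    0 < (refB reg m 𝒞.f₀ s k).re ∧ (refB reg m 𝒞.f₀ s k).im = 0 := by
  rw [refB_eq_of_twoPoint_eq_one 𝒞 h1, Complex.ofReal_re, Complex.ofReal_im]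
  exact ⟨inv_pos.2 (pow_pos (𝒞.z_pos m s k) 2), rfl⟩

/-- **Clause (iii) ⇒ bare reference positivity** (the converse of the landed W2 route): the eventual
calibration identities of `glue` and of the flavour-changing `pseudoRe f g` make `Re refB` eventually
positive. -/
theorem bareRefPositivity_of_calibration {reg : QCDRegularisation Nf} (𝒞 : CalibratedSpeciesFamily reg)
    {m : Fin Nf → ℝ}
    (hcal₁ : ∀ᶠ k in Filter.atTop,
      (𝒞.scheme m).twoPoint k QCDField.glue QCDField.glue (thetaTest 4 𝒞.f₀) 𝒞.f₀ = 1)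
    (hcal₂ : ∀ f g : Fin Nf, f ≠ g → ∀ᶠ k in Filter.atTop,
      (𝒞.scheme m).twoPoint k (QCDField.pseudoRe f g) (QCDField.pseudoRe f g) (thetaTest 4 𝒞.f₀) 𝒞.f₀ = 1) :
    BareRefPositivity reg m 𝒞.f₀ :=
  ⟨hcal₁.mono fun _ hk => (refB_pos_of_twoPoint_eq_one 𝒞 hk).1, fun f g hfg =>
    (hcal₂ f g hfg).mono fun _ hk => (refB_pos_of_twoPoint_eq_one 𝒞 hk).1⟩

/-- **Clause (iv) ⇒ bare skewness** (the converse of the landed W3/W6 route): the `κ₃` clause of a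
calibrated family with calibrated `glue` gives the scale-free skewness of the bare glue three-point
function (one-point subtraction, W1 multilinearity, `z_glue = (Re refB_glue)^{-1/2}`, pinned
counterterm of `glue` at the honest steps). -/
theorem bareSkewness_of_kappa3 {reg : QCDRegularisation Nf} (𝒞 : CalibratedSpeciesFamily reg)
    {m : Fin Nf → ℝ}
    (hcal₁ : ∀ᶠ k in Filter.atTop,
      (𝒞.scheme m).twoPoint k QCDField.glue QCDField.glue (thetaTest 4 𝒞.f₀) 𝒞.f₀ = 1)
    (hκ : ∃ f g h : SchwartzMap (EuclideanSpace ℝ (Fin 4)) ℝ,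
      tsupport (f : EuclideanSpace ℝ (Fin 4) → ℝ) ⊆ {x | x 0 < 0} ∧
      tsupport (g : EuclideanSpace ℝ (Fin 4) → ℝ) ⊆ {x | 0 < x 0 ∧ x 0 < 1} ∧
      tsupport (h : EuclideanSpace ℝ (Fin 4) → ℝ) ⊆ {x | 1 < x 0} ∧
      ∃ ε > (0 : ℝ), ∀ᶠ k in Filter.atTop, ε ≤
        ‖qcdLatticeSchwinger (𝒞.scheme m) k 3 ![QCDField.glue, QCDField.glue, QCDField.glue] ![f, g, h] -
          qcdLatticeSchwinger (𝒞.scheme m) k 1 ![QCDField.glue] ![f] *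
            qcdLatticeSchwinger (𝒞.scheme m) k 2 ![QCDField.glue, QCDField.glue] ![g, h] -
          qcdLatticeSchwinger (𝒞.scheme m) k 1 ![QCDField.glue] ![g] *
            qcdLatticeSchwinger (𝒞.scheme m) k 2 ![QCDField.glue, QCDField.glue] ![f, h] -
          qcdLatticeSchwinger (𝒞.scheme m) k 1 ![QCDField.glue] ![h] *
            qcdLatticeSchwinger (𝒞.scheme m) k 2 ![QCDField.glue, QCDField.glue] ![f, g] +
          2 * (qcdLatticeSchwinger (𝒞.scheme m) k 1 ![QCDField.glue] ![f] *
            qcdLatticeSchwinger (𝒞.scheme m) k 1 ![QCDField.glue] ![g] *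
            qcdLatticeSchwinger (𝒞.scheme m) k 1 ![QCDField.glue] ![h])‖) :
    BareSkewness reg m 𝒞.f₀ := by
  obtain ⟨f, g, h, hf, hg, hh, ε, hε, hev⟩ := hκ
  refine ⟨f, g, h, hf, hg, hh, ε, hε, ?_⟩
  filter_upwards [hcal₁, hev] with k h1 hk
  rw [qcdLatticeSchwinger_one_vecCons_eq_zero 𝒞 m k QCDField.glue f,
    qcdLatticeSchwinger_one_vecCons_eq_zero 𝒞 m k QCDField.glue g,
    qcdLatticeSchwinger_one_vecCons_eq_zero 𝒞 m k QCDField.glue h] at hk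
  simp only [zero_mul, mul_zero, sub_zero, add_zero] at hk
  have hD := den_ne_zero_of_twoPoint_eq_one 𝒞 h1
  -- W1: the renormalised three-point function is `z_glue³` times the bare one (same counterterms)
  have h3 := stub_schwingerMultilinear Nf reg m (𝒞.z m) (𝒞.shift m) k 3
    ![QCDField.glue, QCDField.glue, QCDField.glue] ![f, g, h]
  rw [← CalibratedSpeciesFamily.scheme_eq] at h3
  have hprod : (∏ i : Fin 3, ((𝒞.z m ((![QCDField.glue, QCDField.glue, QCDField.glue] :
      Fin 3 → QCDField Nf) i) k : ℝ) : ℂ)) = (((𝒞.z m QCDField.glue k) ^ 3 : ℝ) : ℂ) := by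
    simp only [Fin.prod_univ_three, Matrix.cons_val_zero, Matrix.cons_val_one, Matrix.cons_val_two,
      Matrix.head_cons, Matrix.tail_cons]
    push_cast
    ring
  -- the counterterm of `glue` is pinned at the honest step `k`
  have hcongr : qcdLatticeSchwinger (reg.scheme m (fun _ _ => (1 : ℝ)) (𝒞.shift m)) k 3
      ![QCDField.glue, QCDField.glue, QCDField.glue] ![f, g, h] =
      qcdLatticeSchwinger (reg.scheme m (fun _ _ => (1 : ℝ)) (pinnedShiftOf reg m)) k 3
        ![QCDField.glue, QCDField.glue, QCDField.glue] ![f, g, h] :=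
    schwinger_congr reg m _ (fun _ => rfl)
      (fun i => by fin_cases i <;> exact shift_eq_pinnedShiftOf 𝒞 m QCDField.glue hD)
  rw [h3, hprod, hcongr, norm_mul, Complex.norm_real, Real.norm_eq_abs,
    abs_of_pos (pow_pos (𝒞.z_pos m QCDField.glue k) 3)] at hk
  -- `√(Re refB_glue) = z_glue⁻¹`
  have hsqrt : Real.sqrt (refB reg m 𝒞.f₀ QCDField.glue k).re = (𝒞.z m QCDField.glue k)⁻¹ := by
    rw [refB_eq_of_twoPoint_eq_one 𝒞 h1, Complex.ofReal_re, Real.sqrt_inv,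
      Real.sqrt_sq (𝒞.z_pos m QCDField.glue k).le]
  have hz3 : 0 < 𝒞.z m QCDField.glue k ^ 3 := pow_pos (𝒞.z_pos m QCDField.glue k) 3
  rw [hsqrt, inv_pow]
  calc ε * (𝒞.z m QCDField.glue k ^ 3)⁻¹
      ≤ (𝒞.z m QCDField.glue k ^ 3 *
          ‖qcdLatticeSchwinger (reg.scheme m (fun _ _ => (1 : ℝ)) (pinnedShiftOf reg m)) k 3
            ![QCDField.glue, QCDField.glue, QCDField.glue] ![f, g, h]‖) *
          (𝒞.z m QCDField.glue k ^ 3)⁻¹ :=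
        mul_le_mul_of_nonneg_right hk (inv_nonneg.2 hz3.le)
    _ = ‖qcdLatticeSchwinger (reg.scheme m (fun _ _ => (1 : ℝ)) (pinnedShiftOf reg m)) k 3
            ![QCDField.glue, QCDField.glue, QCDField.glue] ![f, g, h]‖ := by
        rw [mul_comm (𝒞.z m QCDField.glue k ^ 3), mul_inv_cancel_right₀ hz3.ne']

end Summit.QuantumFields.QCD.Cruxes.LadderCauchyRate.Birth

end
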